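import Summits.QuantumAdvantage.QuantumAdvantage.Theorems.CubicForrelationNearExactIsExactTwelveBoundary2932Reduction
import Summits.QuantumAdvantage.QuantumAdvantage.Theorems.CubicForrelationNearExactIsExactTwelveLevelSixDeltaZeroDead

/-!
# Crux `CubicForrelation.NearExactIsExact` (stmt-QuantumAdvantage-14043) — n = 12: a cubic pair with `29/32 ≤ Φ < 1` has BOTH sides at level
  `≥ 6`, each in configuration (β) `#Z = 768` or (γ) `#Z = 512 ∧ E_off = 256`

Certificate seat `b2b-cforr-cert` (gen 23).  HONEST FRAMING: a kernel-checked REDUCTION (standard axioms) about cubic Boolean pairs on 12 bits; it does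
NOT decide whether `29/32` is a value at `n = 12` and claims NO new value of `θ₁₂`.  NOT summit progress.  What is left: HOME/b2b-cforr-cert-g23/
PLAN-N12-928-L6.md ((β) × (β), (β) × (γ), (γ) × (γ)).

`tw23_boundary_reduction2`: `tw23_boundary_reduction` with its third alternative (δ₀) removed by `tw23_levelSix_delta0_false`: in (δ₀) the
budget `768 = 9·32 + 480` is tight, so `e² = 9` exactly on the `32`-set `L` and `e² = 1` on `Z ∖ L`; with `σ` the mod-4 sign this is
`e ∈ {σ, −3σ}` and `L = {e = −3σ}`.

References: Ax (1964) / McEliece (1972); MacWilliams–Sloane (1977) Ch. 13–15; O'Donnell (2014) §3.3.  Axioms: standard.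
-/

set_option linter.dupNamespace false -- D-0017: single-problem summit ⇒ `QuantumAdvantage.QuantumAdvantage` by design

noncomputable section

namespace Summit.QuantumAdvantage.QuantumAdvantage.Theorems.CubicForrelation.NearExactIsExact

open Finset
open Literature.Computability.QuantumComplexity
open Literature.Computability.QuantumComplexity.BuzetChailloux (bxor zeroVec bxor_bxor_cancel_left bxor_zeroVec zeroVec_bxor bxor_comm
  bxor_self)
open Literature.Computability.QuantumComplexity.DerivativeWalsh (W)

/-- **Boundary reduction at `29/32`, second form (12 bits)**: for cubic `f, g` with `29/32 ≤ Φ(f,g) < 1` there is `u''` with `W_g = 64u''`,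
`Φ = 29/32`, `Σ e² = 768` (`e = u'' − (−1)^f`), and `Z = {u'' even}` has `768` points, or `512` points with off-`Z` energy exactly `256`.
NOT summit progress. [this work] -/
theorem tw23_boundary_reduction2 (f g : (Fin (6 + 6) → Bool) → Bool) (hf : IsDegLeFun 3 f) (hg : IsDegLeFun 3 g)
    (hΦ : (29 / 32 : ℝ) ≤ forrelation f g) (hhi : forrelation f g < 1) :
    ∃ u'' : (Fin (6 + 6) → Bool) → ℤ, (∀ x, W (fun y => signOf (g y)) x = (2 : ℝ) ^ 6 * (u'' x : ℝ)) ∧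
      forrelation f g = 29 / 32 ∧ (∑ x, (u'' x - sZ (f x)) ^ 2 : ℤ) = 768 ∧
      (#(univ.filter fun x : Fin (6 + 6) → Bool => ¬ Odd (u'' x)) = 768 ∨
       (#(univ.filter fun x : Fin (6 + 6) → Bool => ¬ Odd (u'' x)) = 512 ∧ ∑ x ∈ univ.filter (fun x => x ∉ (univ.filter fun x : Fin (6 + 6) → Bool => ¬ Odd (u'' x))), (u'' x - sZ (f x)) ^ 2 = 256)) := by
  classical
  obtain ⟨u'', hu'', hΦeq, hB, htri⟩ := tw23_boundary_reduction f g hf hg hΦ hhi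
  refine ⟨u'', hu'', hΦeq, hB, ?_⟩
  rcases htri with h768 | h512 | ⟨h512, hoff, hL32⟩
  · exact Or.inl h768
  · exact Or.inr h512
  exfalso
  obtain ⟨-, ⟨wf, hwf⟩⟩ := tw23_ge2932_levelSix f g hf hg hΦ hhi
  set Z := (univ.filter fun x : Fin (6 + 6) → Bool => ¬ Odd (u'' x)) with hZdef
  have hmemZ : ∀ x, x ∈ Z ↔ ¬ Odd (u'' x) := fun x => by simp [hZdef]
  set e : (Fin (6 + 6) → Bool) → ℤ := fun x => u'' x - sZ (f x) with hedef
  change ∀ y, y ∉ Z → e y = 0 at hoff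
  change (∑ x, e x ^ 2 : ℤ) = 768 at hB
  -- the 9-flat
  obtain ⟨xZ, hxZ⟩ : Z.Nonempty := card_pos.1 (by rw [h512]; norm_num)
  have hp : IsDegLeFun 3 (fun x => decide (Odd (u'' x))) :=
    stub_walshTower stub_axParity (6 + 6) 6 3 g u'' hg hu'' (by intro k hk hkn; omega)
  have hp' : IsDegLeFun (2 + 1) (fun x => decide (Odd (u'' x)) ^^ true) := tb_isDegLeFun_xor_const hp true
  have hfilt : (univ.filter fun x : Fin (6 + 6) → Bool => (decide (Odd (u'' x)) ^^ true) = true) = Z :=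
    filter_congr fun x _ => by simp
  have hmw := mw_flat_of_minweight 2 (fun x => decide (Odd (u'' x)) ^^ true) hp' (by rw [hfilt, h512]; norm_num)
  rw [hfilt] at hmw
  obtain ⟨h0, hadd, hcardV, hcoset⟩ := hmw
  set V₀ := univ.filter (fun a : Fin (6 + 6) → Bool => ∀ x,
    (decide (Odd (u'' (bxor x a))) ^^ true) = (decide (Odd (u'' x)) ^^ true)) with hV₀
  have hS : Z = V₀.image (bxor xZ) := hcoset xZ (by have h := (hmemZ xZ).1 hxZ; simpa using h)
  rw [h512] at hcardV
  -- the values: `e² = 9` on `L`, `e² = 1` on `Z ∖ L`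
  set L := ((univ.filter fun x : Fin (6 + 6) → Bool => ¬ Odd (u'' x)).filter fun x => Odd ((u'' x - sZ (f x) - sZ (decide ((u'' x - sZ (f x)) % 4 = 3))) / 4)) with hLdef
  have heodd : ∀ x, x ∈ Z → Odd (e x) := by
    intro x hx
    have hev := Int.not_odd_iff_even.1 ((hmemZ x).1 hx)
    rcases tp_sZ_cases (f x) with hs | hs <;> simp only [e] <;> rw [hs]
    · exact Int.odd_sub.2 (iff_of_false (Int.not_odd_iff_even.2 hev) (by decide))
    · exact Int.odd_sub.2 (iff_of_false (Int.not_odd_iff_even.2 hev) (by decide))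
  have hlb : ∀ x ∈ Z, (if x ∈ L then (9 : ℤ) else 1) ≤ e x ^ 2 := by
    intro x hx
    have h0' := Int.odd_iff.1 (heodd x hx)
    by_cases hxL : x ∈ L
    · rw [if_pos hxL]
      have hodd : Odd ((e x - sZ (decide (e x % 4 = 3))) / 4) := (mem_filter.1 hxL).2
      have hne : e x ≠ 1 ∧ e x ≠ -1 := by
        constructor
        · intro h1; rw [h1] at hodd; norm_num [sZ] at hodd
        · intro h1; rw [h1] at hodd; norm_num [sZ] at hodd
      have : e x ≤ -3 ∨ 3 ≤ e x := by omega
      rcases this with h | h <;> nlinarith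
    · rw [if_neg hxL]
      have : e x ≤ -1 ∨ 1 ≤ e x := by omega
      rcases this with h | h <;> nlinarith
  have hZsum : ∑ x ∈ Z, e x ^ 2 = 768 := by
    have hsplit : (∑ x, e x ^ 2 : ℤ) = ∑ x ∈ Z, e x ^ 2 + ∑ x ∈ univ.filter (fun x => x ∉ Z), e x ^ 2 := by
      rw [← sum_filter_add_sum_filter_not univ (fun x => x ∈ Z)]
      congr 1
      exact sum_congr (by ext x; simp) fun _ _ => rfl
    have hz : ∑ x ∈ univ.filter (fun x => x ∉ Z), e x ^ 2 = 0 :=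
      sum_eq_zero fun x hx => by rw [hoff x (mem_filter.1 hx).2]; ring
    linarith
  have hlbsum : ∑ x ∈ Z, (if x ∈ L then (9 : ℤ) else 1) = 768 := by
    rw [← sum_filter_add_sum_filter_not Z (fun x => x ∈ L)]
    have hLZ : L ⊆ Z := filter_subset _ _
    have e1 : Z.filter (fun x => x ∈ L) = L := (filter_mem_eq_inter).trans (inter_eq_right.2 hLZ)
    have h1 : ∑ x ∈ Z.filter (fun x => x ∈ L), (if x ∈ L then (9 : ℤ) else 1) = 9 * 32 := by
      rw [e1, sum_congr rfl fun x hx => if_pos hx, sum_const, hL32, nsmul_eq_mul]; norm_num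
    have h2 : ∑ x ∈ Z.filter (fun x => x ∉ L), (if x ∈ L then (9 : ℤ) else 1) = #(Z.filter fun x => x ∉ L) := by
      rw [sum_congr rfl fun x hx => if_neg (mem_filter.1 hx).2, sum_const, nsmul_eq_mul, mul_one]
    have hc : #(Z.filter fun x => x ∉ L) + #L = #Z := by
      have := card_filter_add_card_filter_not (s := Z) (fun x => x ∈ L)
      rw [e1] at this; omega
    rw [h1, h2]
    have : (#(Z.filter fun x => x ∉ L) : ℤ) = 480 := by
      have h' : #(Z.filter fun x => x ∉ L) = 480 := by rw [h512, hL32] at hc; omega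
      exact_mod_cast h'
    linarith
  have htight := (sum_eq_sum_iff_of_le hlb).1 (by rw [hlbsum, hZsum])
  -- hence `e ∈ {σ, −3σ}` and `T = L`
  set hb : (Fin (6 + 6) → Bool) → Bool := fun x => decide (e x % 4 = 3) with hhb
  have hfour : ∀ x ∈ Z, e x = 1 ∨ e x = -1 ∨ e x = 3 ∨ e x = -3 := by
    intro x hx
    have h := (htight x hx).symm
    by_cases hxL : x ∈ L
    · rw [if_pos hxL] at h
      have : (e x - 3) * (e x + 3) = 0 := by nlinarith
      rcases mul_eq_zero.1 this with h' | h'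
      · exact Or.inr (Or.inr (Or.inl (by linarith)))
      · exact Or.inr (Or.inr (Or.inr (by linarith)))
    · rw [if_neg hxL] at h
      have : (e x - 1) * (e x + 1) = 0 := by nlinarith
      rcases mul_eq_zero.1 this with h' | h'
      · exact Or.inl (by linarith)
      · exact Or.inr (Or.inl (by linarith))
  have hvals : ∀ x ∈ Z, e x = sZ (hb x) ∨ e x = -3 * sZ (hb x) := by
    intro x hx
    simp only [hb]
    rcases hfour x hx with h | h | h | h <;> rw [h] <;> decide
  have key : ∀ x ∈ Z, (e x = -3 * sZ (hb x) ↔ Odd ((e x - sZ (decide (e x % 4 = 3))) / 4)) := by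
    intro x hx
    simp only [hb]
    rcases hfour x hx with h | h | h | h <;> rw [h] <;> norm_num [sZ, Int.odd_iff]
  have hTL : (Z.filter fun x => e x = -3 * sZ (hb x)) = L := by
    ext x
    constructor
    · intro hx'
      obtain ⟨hxZ', hT'⟩ := mem_filter.1 hx'
      exact mem_filter.2 ⟨hxZ', (key x hxZ').1 hT'⟩
    · intro hx'
      obtain ⟨hxZ', hL'⟩ := mem_filter.1 hx'
      exact mem_filter.2 ⟨hxZ', (key x hxZ').2 hL'⟩
  have hT : #(Z.filter fun x => e x = -3 * sZ (hb x)) = 32 := by rw [hTL, hL32]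
  have hlo : (7 / 8 : ℝ) < forrelation f g := by linarith
  exact tw23_levelSix_delta0_false f g hf hg u'' hu'' V₀ xZ h0 hadd hcardV hS hoff hb hvals hT wf hwf hlo hhi

/-- **Symmetric form** (`Φ(g,f) = Φ(f,g)`): the other side is at level `≥ 6` in configuration (β) or (γ) as well. [this work] -/
theorem tw23_boundary_reduction2_symm (f g : (Fin (6 + 6) → Bool) → Bool) (hf : IsDegLeFun 3 f) (hg : IsDegLeFun 3 g)
    (hΦ : (29 / 32 : ℝ) ≤ forrelation f g) (hhi : forrelation f g < 1) :
    ∃ wf : (Fin (6 + 6) → Bool) → ℤ, (∀ y, W (fun x => signOf (f x)) y = (2 : ℝ) ^ 6 * (wf y : ℝ)) ∧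
      forrelation g f = 29 / 32 ∧ (∑ y, (wf y - sZ (g y)) ^ 2 : ℤ) = 768 ∧
      (#(univ.filter fun y : Fin (6 + 6) → Bool => ¬ Odd (wf y)) = 768 ∨
       (#(univ.filter fun y : Fin (6 + 6) → Bool => ¬ Odd (wf y)) = 512 ∧
          ∑ y ∈ univ.filter (fun y => y ∉ (univ.filter fun y : Fin (6 + 6) → Bool => ¬ Odd (wf y))), (wf y - sZ (g y)) ^ 2 = 256)) := by
  have hΦ' : forrelation g f = forrelation f g := by
    rw [Summit.QuantumAdvantage.QuantumAdvantage.Theorems.SignedCubicForrelationNotPrBPP.Negative.HalfQuad.forrelation_comm]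
  exact tw23_boundary_reduction2 g f hg hf (by rw [hΦ']; exact hΦ) (by rw [hΦ']; exact hhi)

end Summit.QuantumAdvantage.QuantumAdvantage.Theorems.CubicForrelation.NearExactIsExact

end
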